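import Mathlib
import Summits.Ventures.PercRepro2.Graph
import Summits.Ventures.PercRepro2.TypedHarrisComplement

/-!
# The contracted typed count: deletion identity and the induction principle
(blind cell PercRepro2, night-3 g25, 2026-08-29; `proofs/NIGHT3-CERT.md` §34.2, §34.7)

For free edges `S` and contracted edges `C` (open on both sides) the **contracted typed count** is
`T(S, C) = Σ_{ω ≤ 1_S : v ∈ C_s(ω)} (F(C_s(ω ⊔ 1_C)) − F(C_s(ω̄ ⊔ 1_C)))·(G(C_s(ω ⊔ 1_C)) − G(C_s(ω̄ ⊔ 1_C)))`,
`ω̄` the complement of `ω` within `S`; `C = ∅` is the typed point-split count of §33.1, and `T(S, C)`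
is the family the edge-induction produces (§34.2: the clusters of the merged source, the weight of
the unmerged one).  This file proves

* **`typedCount_deletion`** — the exact deletion identity at a free edge `e`:
  `T(S, C) = T(S ∖ e, C) + T(S ∖ e, C ∪ e) + box + pivotal`, with `box ≥ 0` for monotone `F, G`
  (`boxSum_nonneg`) and `pivotal` the forced-red sum over the colourings where `e` is red-pivotal
  for `s ↔ v`;
* **`typedCount_univ_empty`** — `T(univ, ∅)` is the typed point-split count in the language of
  `TypedHarrisComplement` (`flipConfig`).

The base case and the induction principle («the step at safe edges ⟹ `T ≥ 0`») are in
`TypedCountInduction.lean`.  Own work; standard axioms.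
-/

namespace Summit.Ventures.PercRepro2

namespace TypedDeletion

variable {V : Type*} {E : Type*}

/-- The configuration `ω ⊔ 1_C`: the edges of `C` forced open. -/
def withC [DecidableEq E] (C : Finset E) (ω : Config E) : Config E := fun e => ω e || decide (e ∈ C)

/-- The complement of `ω` within `S` (edges outside `S` closed). -/
def flipOn [DecidableEq E] (S : Finset E) (ω : Config E) : Config E :=
  fun e => decide (e ∈ S) && !ω e

/-- `ω` is supported on `S`. -/
def OnS (S : Finset E) (ω : Config E) : Prop := ∀ e, ω e = true → e ∈ S

section Defs

variable [Fintype E] [DecidableEq E] {R : Type*} [CommRing R]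

open Classical in
/-- The weight `[v ∈ C_s(ω)]` (the unmerged cluster). -/
noncomputable def wt (ends : E → Sym2 V) (s v : V) (ω : Config E) : R :=
  if v ∈ cluster ends ω s then 1 else 0

/-- The cluster difference `(F P − F Q)(G P − G Q)`. -/
def dlt (F G : Set V → R) (P Q : Set V) : R := (F P - F Q) * (G P - G Q)

open Classical in
/-- The contracted typed count `T(S, C)`. -/
noncomputable def typedCount (ends : E → Sym2 V) (s v : V) (F G : Set V → R) (S C : Finset E) : R :=
  ∑ ω : Config E, if OnS S ω then
    wt ends s v ω * dlt F G (cluster ends (withC C ω) s) (cluster ends (withC C (flipOn S ω)) s)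
  else 0

end Defs

/-! ## Configuration bookkeeping -/

section Bookkeeping

variable [DecidableEq E]

/-- Evaluation of `withC`. -/
lemma withC_apply (C : Finset E) (ω : Config E) (e : E) : withC C ω e = (ω e || decide (e ∈ C)) := rfl

/-- Evaluation of `flipOn`. -/
lemma flipOn_apply (S : Finset E) (ω : Config E) (e : E) :
    flipOn S ω e = (decide (e ∈ S) && !ω e) := rfl

/-- `ω ≤ ω ⊔ 1_C`. -/
lemma le_withC (C : Finset E) (ω : Config E) : ω ≤ withC C ω := by
  intro e
  simp only [withC_apply]
  cases ω e <;> simp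

/-- `withC` is monotone. -/
lemma withC_mono (C : Finset E) {ω ω' : Config E} (h : ω ≤ ω') : withC C ω ≤ withC C ω' := by
  intro e
  simp only [withC_apply]
  have := h e
  cases hω : ω e <;> cases hω' : ω' e <;> simp_all
  exact absurd this (by simp)

/-- Forcing one more edge: `withC (insert e C) ω = withC C (update ω e true)`. -/
lemma withC_insert (C : Finset E) (e : E) (ω : Config E) :
    withC (insert e C) ω = withC C (Function.update ω e true) := by
  funext e'
  simp only [withC_apply]
  by_cases h : e' = e
  · subst h; simp
  · simp [h]

/-- For `ω` supported on `S ∖ e`: the complement within `S` is the complement within `S ∖ e` with `e`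
forced open. -/
lemma flipOn_of_onS_erase {S : Finset E} {e : E} (he : e ∈ S) {ω : Config E}
    (hω : OnS (S.erase e) ω) :
    flipOn S ω = Function.update (flipOn (S.erase e) ω) e true := by
  funext e'
  simp only [flipOn_apply]
  by_cases h : e' = e
  · subst h
    have : ω e' = false := by
      by_contra hc
      have := hω e' (by simpa using hc)
      simp at this
    simp [he, this]
  · rw [Function.update_of_ne h, flipOn_apply]
    have : decide (e' ∈ S.erase e) = decide (e' ∈ S) := by simp [Finset.mem_erase, h]
    rw [this]

/-- For `ω` supported on `S ∖ e`: the complement within `S` of `ω` with `e` opened is the complement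
within `S ∖ e` of `ω`. -/
lemma flipOn_update_true {S : Finset E} {e : E} (ω : Config E) :
    flipOn S (Function.update ω e true) = flipOn (S.erase e) ω := by
  funext e'
  simp only [flipOn_apply]
  by_cases h : e' = e
  · subst h; simp
  · rw [Function.update_of_ne h]
    have : decide (e' ∈ S.erase e) = decide (e' ∈ S) := by simp [Finset.mem_erase, h]
    rw [this]

/-- The erased support: `ω` supported on `S ∖ e` iff supported on `S` with `ω e = false`. -/
lemma onS_erase_iff {S : Finset E} {e : E} (he : e ∈ S) {ω : Config E} :
    OnS (S.erase e) ω ↔ OnS S ω ∧ ω e = false := by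
  constructor
  · intro h
    refine ⟨fun e' he' => Finset.mem_of_mem_erase (h e' he'), ?_⟩
    by_contra hc
    have := h e (by simpa using hc)
    simp at this
  · rintro ⟨h, he0⟩ e' he'
    rw [Finset.mem_erase]
    refine ⟨?_, h e' he'⟩
    rintro rfl
    rw [he0] at he'
    exact Bool.false_ne_true he'

/-- Opening `e ∈ S` keeps the support in `S`. -/
lemma onS_update_true {S : Finset E} {e : E} (he : e ∈ S) {ω : Config E} (h : OnS S ω) :
    OnS S (Function.update ω e true) := by
  intro e' he'
  by_cases hee : e' = e
  · subst hee; exact he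
  · rw [Function.update_of_ne hee] at he'
    exact h e' he'

/-- Closing `e` keeps a support in `S` inside `S ∖ e`. -/
lemma onS_erase_update_false {S : Finset E} {e : E} {ω : Config E} (h : OnS S ω) :
    OnS (S.erase e) (Function.update ω e false) := by
  intro e' he'
  by_cases hee : e' = e
  · subst hee; simp at he'
  · rw [Function.update_of_ne hee] at he'
    exact Finset.mem_erase.2 ⟨hee, h e' he'⟩

/-- The involution `ω ↦ ω` with the edge `e` flipped. -/
def flipE (e : E) : Equiv.Perm (Config E) :=
  Function.Involutive.toPerm (fun ω => Function.update ω e (!ω e)) (by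
    intro ω
    funext e'
    by_cases h : e' = e
    · subst h; simp
    · simp [Function.update_of_ne h])

/-- Evaluation of `flipE`. -/
lemma flipE_apply (e : E) (ω : Config E) : flipE e ω = Function.update ω e (!ω e) := rfl

end Bookkeeping

/-! ## The deletion identity -/

section Deletion

variable [Fintype E] [DecidableEq E] {R : Type*} [CommRing R]

open Classical in
/-- The box terms at the free edge `e`: `(F r⁺ − F r)(G b⁺ − G b) + (F b⁺ − F b)(G r⁺ − G r)` on the
colourings of `S ∖ e` with `v ∈ C_s(ω)`. -/
noncomputable def boxSum (ends : E → Sym2 V) (s v : V) (F G : Set V → R) (S C : Finset E) (e : E) :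
    R :=
  ∑ ω : Config E, if OnS (S.erase e) ω then
    wt ends s v ω *
      ((F (cluster ends (withC C (Function.update ω e true)) s) - F (cluster ends (withC C ω) s)) *
        (G (cluster ends (withC C (Function.update (flipOn (S.erase e) ω) e true)) s) -
          G (cluster ends (withC C (flipOn (S.erase e) ω)) s)) +
       (F (cluster ends (withC C (Function.update (flipOn (S.erase e) ω) e true)) s) -
          F (cluster ends (withC C (flipOn (S.erase e) ω)) s)) *
        (G (cluster ends (withC C (Function.update ω e true)) s) - G (cluster ends (withC C ω) s)))
  else 0

open Classical in
/-- The pivotal forced-red sum at `e`: the colourings of `S ∖ e` where `e` is red-pivotal for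
`s ↔ v`, with `e` red and the clusters of the merged source. -/
noncomputable def pivotalSum (ends : E → Sym2 V) (s v : V) (F G : Set V → R) (S C : Finset E)
    (e : E) : R :=
  ∑ ω : Config E, if OnS (S.erase e) ω then
    (if v ∈ cluster ends (Function.update ω e true) s ∧ v ∉ cluster ends ω s then (1 : R) else 0) *
      dlt F G (cluster ends (withC C (Function.update ω e true)) s)
        (cluster ends (withC C (flipOn (S.erase e) ω)) s)
  else 0

/-- Splitting a sum over configurations by the value at `e`, the open half reindexed by `flipE`. -/
lemma sum_config_split (e : E) (h : Config E → R) :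
    ∑ ω : Config E, h ω =
      ∑ ω : Config E, (if ω e = false then h ω else 0) +
        ∑ ω : Config E, (if ω e = false then h (Function.update ω e true) else 0) := by
  have h1 : ∑ ω : Config E, h ω =
      ∑ ω : Config E, ((if ω e = false then h ω else 0) + (if ω e = true then h ω else 0)) := by
    refine Finset.sum_congr rfl fun ω _ => ?_
    cases hω : ω e <;> simp
  rw [h1, Finset.sum_add_distrib]
  congr 1
  rw [← Equiv.sum_comp (flipE e)]
  refine Finset.sum_congr rfl fun ω _ => ?_
  simp only [flipE_apply]
  cases hω : ω e <;> simp

/-- **The deletion identity** at a free edge `e ∈ S`: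
`T(S, C) = T(S ∖ e, C) + T(S ∖ e, C ∪ e) + box + pivotal`. -/
theorem typedCount_deletion (ends : E → Sym2 V) (s v : V) (F G : Set V → R) (S C : Finset E)
    {e : E} (he : e ∈ S) :
    typedCount ends s v F G S C =
      typedCount ends s v F G (S.erase e) C + typedCount ends s v F G (S.erase e) (insert e C) +
        boxSum ends s v F G S C e + pivotalSum ends s v F G S C e := by
  classical
  unfold typedCount boxSum pivotalSum
  rw [sum_config_split e, ← Finset.sum_add_distrib, ← Finset.sum_add_distrib,
    ← Finset.sum_add_distrib, ← Finset.sum_add_distrib]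
  refine Finset.sum_congr rfl fun ω _ => ?_
  by_cases he0 : ω e = false
  · by_cases hω : OnS (S.erase e) ω
    · have hS : OnS S ω := ((onS_erase_iff he).1 hω).1
      have hS' : OnS S (Function.update ω e true) := onS_update_true he hS
      simp only [he0, if_true, hS, hS', hω, withC_insert, flipOn_of_onS_erase he hω,
        flipOn_update_true]
      have hmono : cluster ends ω s ⊆ cluster ends (Function.update ω e true) s :=
        cluster_mono (by
          intro e'
          by_cases h : e' = e
          · subst h; simp
          · simp [Function.update_of_ne h]) s
      by_cases hv : v ∈ cluster ends ω s
      · have hv' : v ∈ cluster ends (Function.update ω e true) s := hmono hv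
        have w1 : wt ends s v ω = (1 : R) := by simp [wt, hv]
        have w2 : wt ends s v (Function.update ω e true) = (1 : R) := by simp [wt, hv']
        have p0 : (if v ∈ cluster ends (Function.update ω e true) s ∧ v ∉ cluster ends ω s
            then (1 : R) else 0) = 0 := by simp [hv]
        rw [w1, w2, p0]
        simp only [dlt]
        ring
      · have w1 : wt ends s v ω = (0 : R) := by simp [wt, hv]
        by_cases hv' : v ∈ cluster ends (Function.update ω e true) s
        · have w2 : wt ends s v (Function.update ω e true) = (1 : R) := by simp [wt, hv']
          have p1 : (if v ∈ cluster ends (Function.update ω e true) s ∧ v ∉ cluster ends ω s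
              then (1 : R) else 0) = 1 := by simp [hv, hv']
          rw [w1, w2, p1]
          simp only [dlt]
          ring
        · have w2 : wt ends s v (Function.update ω e true) = (0 : R) := by simp [wt, hv']
          have p0 : (if v ∈ cluster ends (Function.update ω e true) s ∧ v ∉ cluster ends ω s
              then (1 : R) else 0) = 0 := by simp [hv']
          rw [w1, w2, p0]
          simp only [dlt]
          ring
    · have hS : ¬ OnS S ω := fun h => hω ((onS_erase_iff he).2 ⟨h, he0⟩)
      have hS' : ¬ OnS S (Function.update ω e true) := fun h => hω (fun e' he' => by
        have hne : e' ≠ e := by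
          rintro rfl
          rw [he0] at he'
          exact Bool.false_ne_true he'
        exact Finset.mem_erase.2 ⟨hne, h e' (by rw [Function.update_of_ne hne]; exact he')⟩)
      simp [he0, hS, hS', hω]
  · have he1 : ω e = true := by simpa using he0
    have hω : ¬ OnS (S.erase e) ω := fun h => by
      have := h e he1
      simp at this
    simp [he0, hω]

end Deletion

/-! ## The box terms are nonnegative -/

section Box

variable [Fintype E] [DecidableEq E] {R : Type*} [Field R] [LinearOrder R] [IsStrictOrderedRing R]

omit [Fintype E] in
/-- `ω ≤ ω` with `e` opened. -/
lemma le_update_true (ω : Config E) (e : E) : ω ≤ Function.update ω e true := by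
  intro e'
  by_cases h : e' = e
  · subst h; simp
  · simp [Function.update_of_ne h]

/-- The box terms are nonnegative for monotone `F, G`. -/
theorem boxSum_nonneg (ends : E → Sym2 V) (s v : V) {F G : Set V → R} (hF : Monotone F)
    (hG : Monotone G) (S C : Finset E) (e : E) : 0 ≤ boxSum ends s v F G S C e := by
  classical
  unfold boxSum
  apply Finset.sum_nonneg
  intro ω _
  split_ifs with hω
  · have hw : (0 : R) ≤ wt ends s v ω := by
      unfold wt; split_ifs <;> norm_num
    refine mul_nonneg hw ?_
    have hr : cluster ends (withC C ω) s ⊆ cluster ends (withC C (Function.update ω e true)) s :=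
      cluster_mono (withC_mono C (le_update_true ω e)) s
    have hb : cluster ends (withC C (flipOn (S.erase e) ω)) s ⊆
        cluster ends (withC C (Function.update (flipOn (S.erase e) ω) e true)) s :=
      cluster_mono (withC_mono C (le_update_true _ e)) s
    have h1 := sub_nonneg.mpr (hF hr)
    have h2 := sub_nonneg.mpr (hG hb)
    have h3 := sub_nonneg.mpr (hF hb)
    have h4 := sub_nonneg.mpr (hG hr)
    exact add_nonneg (mul_nonneg h1 h2) (mul_nonneg h3 h4)
  · exact le_rfl

end Box

/-! ## The count at `(univ, ∅)` is the typed point-split count -/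

section Bridge

variable [Fintype E] [DecidableEq E] {R : Type*} [CommRing R]

omit [Fintype E] in
/-- No contracted edge: `withC ∅ ω = ω`. -/
lemma withC_empty (ω : Config E) : withC (∅ : Finset E) ω = ω := by
  funext e; simp [withC_apply]

/-- The complement within all edges is the complementary colouring of `TypedHarrisComplement`. -/
lemma flipOn_univ (ω : Config E) : flipOn (Finset.univ : Finset E) ω = TypedHarris.flipConfig ω := by
  funext e; simp [flipOn_apply, TypedHarris.flipConfig]

open Classical in
/-- **The typed point-split count** (§33.1) is `T(univ, ∅)`:
`Σ_ω [v ∈ C_s(ω)] (F(C_s(ω)) − F(C_s(ω̄)))(G(C_s(ω)) − G(C_s(ω̄)))` with `ω̄ = flipConfig ω`. -/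
theorem typedCount_univ_empty (ends : E → Sym2 V) (s v : V) (F G : Set V → R) :
    typedCount ends s v F G Finset.univ ∅ =
      ∑ ω : Config E, (if v ∈ cluster ends ω s then (1 : R) else 0) *
        ((F (cluster ends ω s) - F (cluster ends (TypedHarris.flipConfig ω) s)) *
          (G (cluster ends ω s) - G (cluster ends (TypedHarris.flipConfig ω) s))) := by
  unfold typedCount
  refine Finset.sum_congr rfl fun ω _ => ?_
  have hS : OnS Finset.univ ω := fun e _ => Finset.mem_univ e
  rw [if_pos hS, withC_empty, withC_empty, flipOn_univ]
  simp only [wt, dlt]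

end Bridge



end TypedDeletion

end Summit.Ventures.PercRepro2
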